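import Summits.ValiantsHypothesis.ValiantsHypothesis.Theorems.LacunarySymmetroidMatrixDescartesCensusPivotTwoTwoIndexOne
import Summits.ValiantsHypothesis.ValiantsHypothesis.Theorems.LacunarySymmetroidMatrixDescartesCensusPivotIndexRung

/-!
# `MatrixDescartes` census — pivot column at `m = 2`: the ONE-LETTER row at every size, and the INDEX-ONE TABLE
# `(2,1)₁ = 1`, `(2,2)₁ = 4`, `(2,3)₁ = 6`, `8 ≤ (2,4)₁ ≤ 10`

HONEST FRAMING.  Object-search cell `pub-symmetroid`, Conjecture-B column in PIVOT currency (`…CensusPivotDefs.lean`, seat conjb-1),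
seat `val-sym-mdr-p1` (generation 6).  Helper file landed `--supports` the crux item stmt-ValiantsHypothesis-18050
(`Theses.LacunarySymmetroid.MatrixDescartes`, OPEN, on HOLD) with NO closure claim.  Bookkeeping that ASSEMBLES the kernel rows of
conjb-1's index-one column at `m = 2` (the `RankOnePivotLaw*` family) into one statement, plus the `K = 1` row at every size:
* **`pivotRootLawAt_one_letter`** (every `m`, every `q`): `PivotRootLawAt m 1 q q` — a one-letter pivot pencil is always one-sided, so the
  tree's R0 (`Pivot.oneSidedIndexRung_holds`, conjb-1 g0) applies: `Z₊ ≤ q`; with **`not_pivotRootLawAt_two_one_one_zero`** (`J = diag(−1,0)`,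
  `P = 1` at exponent `1`: `det = t(t − 1)`, one positive root) the `(2,1)` row at index one is exactly `1`
  (**`pivotRootLawAt_two_one_one_iff`**).
* **`indexOne_column_two`** (the table): `(∀ B, PivotRootLawAt 2 1 1 B ↔ 1 ≤ B) ∧ (∀ B, PivotRootLawAt 2 2 1 B ↔ 4 ≤ B) ∧
  (∀ B, PivotRootLawAt 2 3 1 B ↔ 6 ≤ B) ∧ ¬ PivotRootLawAt 2 4 1 7 ∧ PivotRootLawAt 2 4 1 10` — rows by R0 + this file (`K = 1`),
  `…CensusPivotTwoTwoIndexOne` / `…TwoSmallRows` (`K = 2`, this seat), `…PivotTwoThree` (`K = 3`, seat g5), `…PivotTwoFourWitness` +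
  `…CensusPivotTwoDescartes` (`K = 4`: g5's eight-root witness and conjb-1's Descartes ceiling `2K + 2`).  So at index one the column is
  `1, 4, 6, {8,9,10}`: the conjectured `2K` holds through `K = 3` (and `K = 1` is below it, `= q`).
Nothing here bears on `Theses.LacunarySymmetroid.MatrixDescartes` in its window, on `KPlusLogSqLaw`, on `DoorA26` / `DoorA34`, on the
cell's registers or credences, or on `VP ≠ VNP`.

[folklore] Assembly of tree theorems; one IVT certificate via `Pivot.not_pivotRootLawAt_of_certificate`.  No definitions, no named facts.
-/

-- `Summit.ValiantsHypothesis.ValiantsHypothesis.…` repeats a component by the D-0017 layout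
-- (single-conjunct summit), which the `dupNamespace` linter flags; the name is mandated.
set_option linter.dupNamespace false

namespace Summit.ValiantsHypothesis.ValiantsHypothesis.Theorems.LacunarySymmetroidMatrixDescartes.Pivot.SmallRows

open Matrix Finset Polynomial
open scoped BigOperators

/-- **The one-letter row at every size and index**: `PivotRootLawAt m 1 q q` (a single PSD letter is one-sided with respect to the
pivot, so R0 gives `Z₊ ≤ q`). [folklore] -/
theorem pivotRootLawAt_one_letter (m q : ℕ) : PivotRootLawAt m 1 q q := by
  intro e d J P hJ hP hW
  refine oneSidedIndexRung_holds m 1 q e d J P hJ hP hW ?_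
  rcases le_total e (d 0) with h | h
  · exact Or.inl fun k => by fin_cases k; exact h
  · exact Or.inr fun k => by fin_cases k; exact h

/-- Closed form for the `(2,1)` index-one witness: `J = diag(−1, 0)` at exponent `0`, `P = 1` at exponent `1`:
`det F(t) = t·(t − 1)`. [folklore] -/
theorem witnessOneIdx1_eval_det (t : ℝ) :
    (t ^ 0 • (!![-1, 0; 0, 0] : Matrix (Fin 2) (Fin 2) ℝ)
      + ∑ k, t ^ (![1] : Fin 1 → ℕ) k • (![(1 : Matrix (Fin 2) (Fin 2) ℝ)] : Fin 1 → Matrix (Fin 2) (Fin 2) ℝ) k).det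
      = t * (t - 1) := by
  rw [Matrix.det_fin_two]
  simp [Matrix.add_apply]
  ring

/-- **`(2,1)` at index one is sharp at `1`**: `¬ PivotRootLawAt 2 1 1 0` (the positive root `t = 1`; signs `− +` at `1/2 < 2`). [folklore] -/
theorem not_pivotRootLawAt_two_one_one_zero : ¬ PivotRootLawAt 2 1 1 0 :=
  not_pivotRootLawAt_of_certificate (N := 1) witnessOneIdx1_eval_det
    (by unfold Matrix.IsSymm; ext i j; fin_cases i <;> fin_cases j <;> rfl)
    (by intro k; fin_cases k; simpa using Matrix.PosSemidef.one)
    (!![1; 0] : Matrix (Fin 2) (Fin 1) ℝ) witnessTwoIdx1_index_one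
    ![1 / 2, 2]
    (by
      refine Fin.strictMono_iff_lt_succ.2 fun j => ?_
      fin_cases j; simp only [Fin.castSucc_mk, Fin.succ_mk]; norm_num)
    (by intro j; fin_cases j <;> norm_num)
    (by intro j; fin_cases j; simp only [Fin.castSucc_mk, Fin.succ_mk]; norm_num)
    (by norm_num)

/-- **Row `(2,1)` at index one is exactly `1`**: `PivotRootLawAt 2 1 1 B ↔ 1 ≤ B`. [folklore] -/
theorem pivotRootLawAt_two_one_one_iff (B : ℕ) : PivotRootLawAt 2 1 1 B ↔ 1 ≤ B := by
  constructor
  · intro h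
    by_contra hB
    exact not_pivotRootLawAt_two_one_one_zero (pivotRootLawAt_mono h (by omega))
  · intro hB
    exact pivotRootLawAt_mono (pivotRootLawAt_one_letter 2 1) hB

/-- **THE INDEX-ONE COLUMN AT `m = 2` (kernel table)**: `(2,1)₁ = 1`, `(2,2)₁ = 4`, `(2,3)₁ = 6`, and `8 ≤ (2,4)₁ ≤ 10`
(`¬ PivotRootLawAt 2 4 1 7` and `PivotRootLawAt 2 4 1 10`). [folklore] -/
theorem indexOne_column_two :
    (∀ B, PivotRootLawAt 2 1 1 B ↔ 1 ≤ B) ∧ (∀ B, PivotRootLawAt 2 2 1 B ↔ 4 ≤ B) ∧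
      (∀ B, PivotRootLawAt 2 3 1 B ↔ 6 ≤ B) ∧ (¬ PivotRootLawAt 2 4 1 7 ∧ PivotRootLawAt 2 4 1 10) :=
  ⟨pivotRootLawAt_two_one_one_iff, pivotRootLawAt_two_two_one_iff,
    LacunarySymmetroidMatrixDescartes.pivotRootLawAt_two_three_one_iff,
    ⟨LacunarySymmetroidMatrixDescartes.not_pivotRootLawAt_two_four_one_seven, pivotRootLawAt_two 4 1⟩⟩

end Summit.ValiantsHypothesis.ValiantsHypothesis.Theorems.LacunarySymmetroidMatrixDescartes.Pivot.SmallRows
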